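import Summits.Ventures.PercRepro.S1CoreCapBridge
import Summits.Ventures.PercRepro.S1CoreStar
import Summits.Ventures.PercRepro.FourCircuitCapSum

/-!
# PercRepro — `s₄ ≤ Σ_{j ≤ ν} Q*(j)` on the e-free core, modulo the 4-circuit-cap spec (p1, gen 22; the s₄ seat)

`proofs/P1-S4-CAPBRIDGE.md` §6. p3's generic deletion recursion `FourCircuitCap.ncard_fourCircuits_le_sum_of_perPoint`
(`s₄ ≤ Σ_{j ≤ ν} q j` from a per-point bound `#4circ(e) ≤ q j` on every core of nullity `j`) with
`q j := Q j` for `j ≤ ν` — the bridge `S1CoreCapBridge.ncard_fourCircuitsThrough_le_of_fourCapSpec` under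
`FourCapSpec capPaper j (Q j)` — and `perPointBound j` beyond (`S1CoreStar`; never used in the sum). With the table
`qStar` of the two searches (`1, 4, 5, 8, 11, 16, 19`): `s₄ ≤ 29 / 45 / 64` at `ν = 5 / 6 / 7` — CONDITIONAL on the
computed instances `FourCapSpec capPaper j (qStar j)`, which nothing here proves (they are the hypothesis `hQ`).
Axioms: standard.
-/

open scoped Matroid

namespace PercRepro

namespace S1

open Set

open FourCap

variable {α : Type}

/-- The partial sums `Σ_{j ≤ d} Q j` of a bound sequence. -/
def capSum (Q : ℕ → ℕ) (d : ℕ) : ℕ := (Finset.range (d + 1)).sum Q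

/-- The recursion `capSum Q (d + 1) = capSum Q d + Q (d + 1)`. -/
theorem capSum_succ (Q : ℕ → ℕ) (d : ℕ) : capSum Q (d + 1) = capSum Q d + Q (d + 1) := by
  unfold capSum
  rw [Finset.sum_range_succ]

/-- **`s₄ ≤ Σ_{j ≤ ν} Q(j)`** on the e-free core of nullity `ν`, whenever `FourCapSpec capPaper j (Q j)` holds for
every `j ≤ ν`: p3's generic deletion recursion `FourCircuitCap.ncard_fourCircuits_le_sum_of_perPoint` with the
per-point bound `q j := Q j` for `j ≤ ν` (the bridge) and `perPointBound j` beyond (`S1CoreStar`, never used in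
the sum). -/
theorem ncard_fourCircuits_le_capSum (M : Matroid α) [M.Finite]
    (hfree : ∀ e ∈ M.E, ∃ A ⊆ M.E \ {e}, e ∉ M.closure A ∧ e ∉ M.closure ((M.E \ {e}) \ A))
    {d : ℕ} (hd : M.E.encard = M.eRank + d) (Q : ℕ → ℕ) (hQ : ∀ j ≤ d, FourCapSpec capPaper j (Q j)) :
    {C : Set α | M.IsCircuit C ∧ C.ncard = 4}.ncard ≤ capSum Q d := by
  classical
  let q : ℕ → ℕ := fun j => if j ≤ d then Q j else perPointBound j
  have hq : ∀ (M' : Matroid α) [M'.Finite],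
      (∀ e ∈ M'.E, ∃ A ⊆ M'.E \ {e}, e ∉ M'.closure A ∧ e ∉ M'.closure ((M'.E \ {e}) \ A)) →
      ∀ j : ℕ, M'.E.encard = M'.eRank + j → ∀ e ∈ M'.E,
      {C : Set α | M'.IsCircuit C ∧ C.ncard = 4 ∧ e ∈ C}.ncard ≤ q j := by
    intro M' _ hfree' j hj e he
    by_cases hjd : j ≤ d
    · simp only [q, hjd, if_true]
      exact ncard_fourCircuitsThrough_le_of_fourCapSpec M' hfree' hj he (hQ j hjd)
    · simp only [q, hjd, if_false]
      exact ncard_fourCircuitsThrough_le_perPointBound M' hfree' hj e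
  have h := FourCircuitCap.ncard_fourCircuits_le_sum_of_perPoint q hq M hfree hd
  refine h.trans (le_of_eq ?_)
  unfold capSum
  refine Finset.sum_congr rfl (fun j hj => ?_)
  have : j ≤ d := Nat.lt_succ_iff.1 (Finset.mem_range.1 hj)
  simp only [q, this, if_true]

/-- **The table of the two searches** (p1's fourcap.py and the engine's fourcap.c, paper table): `Q*(ν) = 1, 4, 5,
8, 11, 16, 19` for `ν = 1 … 7`, `Q*(0) = 0`; `0` beyond the computed range. NOTHING HERE PROVES
`FourCapSpec capPaper ν (qStar ν)` — it is a table of COMPUTED values, and the theorems below take that spec as a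
hypothesis. -/
def qStar : ℕ → ℕ
  | 0 => 0
  | 1 => 1
  | 2 => 4
  | 3 => 5
  | 4 => 8
  | 5 => 11
  | 6 => 16
  | 7 => 19
  | _ => 0

/-- `Σ_{j ≤ 5} Q*(j) = 29`. -/
theorem capSum_qStar_five : capSum qStar 5 = 29 := by decide

/-- `Σ_{j ≤ 6} Q*(j) = 45`. -/
theorem capSum_qStar_six : capSum qStar 6 = 45 := by decide

/-- `Σ_{j ≤ 7} Q*(j) = 64`. -/
theorem capSum_qStar_seven : capSum qStar 7 = 64 := by decide

/-- **`s₄ ≤ 45` on every core of nullity 6** — CONDITIONAL on the computed instances `FourCapSpec capPaper j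
(qStar j)`, `j ≤ 6` (the search, two seats). -/
theorem ncard_fourCircuits_le_forty_five (M : Matroid α) [M.Finite]
    (hfree : ∀ e ∈ M.E, ∃ A ⊆ M.E \ {e}, e ∉ M.closure A ∧ e ∉ M.closure ((M.E \ {e}) \ A))
    (hd : M.E.encard = M.eRank + 6) (hQ : ∀ j ≤ 6, FourCapSpec capPaper j (qStar j)) :
    {C : Set α | M.IsCircuit C ∧ C.ncard = 4}.ncard ≤ 45 := by
  have := ncard_fourCircuits_le_capSum M hfree hd qStar hQ
  rwa [capSum_qStar_six] at this


/-- **`s₄` at nullity `d + 1` from the cap spec up to `d` and the star bound at `d + 1`**: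
`s₄ ≤ capSum Q d + perPointBound (d + 1)` — p3's recursion with `q j := Q j` for `j ≤ d` and `perPointBound j` beyond
(`S1CoreStar`, unconditional). -/
theorem ncard_fourCircuits_le_capSum_add_perPointBound (M : Matroid α) [M.Finite]
    (hfree : ∀ e ∈ M.E, ∃ A ⊆ M.E \ {e}, e ∉ M.closure A ∧ e ∉ M.closure ((M.E \ {e}) \ A))
    {d : ℕ} (hd : M.E.encard = M.eRank + (d + 1)) (Q : ℕ → ℕ) (hQ : ∀ j ≤ d, FourCapSpec capPaper j (Q j)) :
    {C : Set α | M.IsCircuit C ∧ C.ncard = 4}.ncard ≤ capSum Q d + perPointBound (d + 1) := by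
  classical
  let q : ℕ → ℕ := fun j => if j ≤ d then Q j else perPointBound j
  have hq : ∀ (M' : Matroid α) [M'.Finite],
      (∀ e ∈ M'.E, ∃ A ⊆ M'.E \ {e}, e ∉ M'.closure A ∧ e ∉ M'.closure ((M'.E \ {e}) \ A)) →
      ∀ j : ℕ, M'.E.encard = M'.eRank + j → ∀ e ∈ M'.E,
      {C : Set α | M'.IsCircuit C ∧ C.ncard = 4 ∧ e ∈ C}.ncard ≤ q j := by
    intro M' _ hfree' j hj e he
    by_cases hjd : j ≤ d
    · simp only [q, hjd, if_true]
      exact ncard_fourCircuitsThrough_le_of_fourCapSpec M' hfree' hj he (hQ j hjd)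
    · simp only [q, hjd, if_false]
      exact ncard_fourCircuitsThrough_le_perPointBound M' hfree' hj e
  have h := FourCircuitCap.ncard_fourCircuits_le_sum_of_perPoint q hq M hfree hd
  refine h.trans (le_of_eq ?_)
  rw [Finset.sum_range_succ]
  change (Finset.range (d + 1)).sum q + q (d + 1) = capSum Q d + perPointBound (d + 1)
  have h1 : (Finset.range (d + 1)).sum q = capSum Q d := by
    unfold capSum
    refine Finset.sum_congr rfl (fun j hj => ?_)
    have : j ≤ d := Nat.lt_succ_iff.1 (Finset.mem_range.1 hj)
    simp only [q, this, if_true]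
  have h2 : q (d + 1) = perPointBound (d + 1) := by
    simp only [q, show ¬ (d + 1 ≤ d) by omega, if_false]
  rw [h1, h2]

/-- `capSum qStar 5 = 29` with the kernel instances at `ν = 0, 1, 2` supplied: only `Q*(3) = 5`, `Q*(4) = 8`,
`Q*(5) = 11` remain computed. -/
theorem fourCapSpec_qStar_le_five (hQ3 : FourCapSpec capPaper 3 5) (hQ4 : FourCapSpec capPaper 4 8)
    (hQ5 : FourCapSpec capPaper 5 11) : ∀ j ≤ 5, FourCapSpec capPaper j (qStar j) := by
  intro j hj
  interval_cases j
  · exact fourCapSpec_zero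
  · exact fourCapSpec_one
  · exact fourCapSpec_two
  · exact hQ3
  · exact hQ4
  · exact hQ5

/-- **`s₄ ≤ 29` on every core of nullity 5** — modulo exactly the three computed instances `Q*(3) = 5`,
`Q*(4) = 8`, `Q*(5) = 11` (the instances at `ν ≤ 2` are kernel theorems of `S1CoreCapSpec`). -/
theorem ncard_fourCircuits_le_twenty_nine (M : Matroid α) [M.Finite]
    (hfree : ∀ e ∈ M.E, ∃ A ⊆ M.E \ {e}, e ∉ M.closure A ∧ e ∉ M.closure ((M.E \ {e}) \ A))
    (hd : M.E.encard = M.eRank + 5) (hQ3 : FourCapSpec capPaper 3 5) (hQ4 : FourCapSpec capPaper 4 8)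
    (hQ5 : FourCapSpec capPaper 5 11) : {C : Set α | M.IsCircuit C ∧ C.ncard = 4}.ncard ≤ 29 := by
  have := ncard_fourCircuits_le_capSum M hfree hd qStar (fourCapSpec_qStar_le_five hQ3 hQ4 hQ5)
  rwa [capSum_qStar_five] at this

/-- **`s₄ ≤ 59` on every core of nullity 6** — modulo the SAME three computed instances (`Q*(3..5)`), the
nullity-6 step being the unconditional star bound `perPointBound 6 = 30`: `29 + 30`. (The instance at `ν = 6`,
`Q*(6) = 16`, is NOT needed for this bound.) -/
theorem ncard_fourCircuits_le_fifty_nine (M : Matroid α) [M.Finite]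
    (hfree : ∀ e ∈ M.E, ∃ A ⊆ M.E \ {e}, e ∉ M.closure A ∧ e ∉ M.closure ((M.E \ {e}) \ A))
    (hd : M.E.encard = M.eRank + 6) (hQ3 : FourCapSpec capPaper 3 5) (hQ4 : FourCapSpec capPaper 4 8)
    (hQ5 : FourCapSpec capPaper 5 11) : {C : Set α | M.IsCircuit C ∧ C.ncard = 4}.ncard ≤ 59 := by
  have := ncard_fourCircuits_le_capSum_add_perPointBound M hfree (d := 5) hd qStar
    (fourCapSpec_qStar_le_five hQ3 hQ4 hQ5)
  rw [capSum_qStar_five] at this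
  have h30 : perPointBound (5 + 1) = 30 := by decide
  omega


/-- **The star step**: if every core of nullity `m` has at most `B` four-circuits through any point, every core of
nullity `m + 1` has at most `⌊3(m+1)/2⌋ + B` — delete a second point `x` of a 4-circuit through `e` (`M ＼ {x}` is a
core of nullity `m`): the circuits through `e, x` are `≤ ⌊3(m+1)/2⌋` (the star bound), the others are 4-circuits of
`M ＼ {x}` through `e`. -/
theorem ncard_fourCircuitsThrough_le_star_add_of_forall (M : Matroid α) [M.Finite]
    (hfree : ∀ e ∈ M.E, ∃ A ⊆ M.E \ {e}, e ∉ M.closure A ∧ e ∉ M.closure ((M.E \ {e}) \ A))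
    {m : ℕ} (hd : M.E.encard = M.eRank + (m + 1)) (e : α) {B : ℕ}
    (hB : ∀ (M' : Matroid α) [M'.Finite],
      (∀ e ∈ M'.E, ∃ A ⊆ M'.E \ {e}, e ∉ M'.closure A ∧ e ∉ M'.closure ((M'.E \ {e}) \ A)) →
      M'.E.encard = M'.eRank + m → ∀ e ∈ M'.E, {C : Set α | M'.IsCircuit C ∧ C.ncard = 4 ∧ e ∈ C}.ncard ≤ B) :
    {C : Set α | M.IsCircuit C ∧ C.ncard = 4 ∧ e ∈ C}.ncard ≤ 3 * (m + 1) / 2 + B := by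
  classical
  set S := {C : Set α | M.IsCircuit C ∧ C.ncard = 4 ∧ e ∈ C} with hS
  have hSfin : S.Finite :=
    M.ground_finite.finite_subsets.subset (fun C hC => hC.1.subset_ground)
  by_cases hSe : S = ∅
  · rw [hSe, ncard_empty]; exact Nat.zero_le _
  obtain ⟨C₀, hC₀⟩ := nonempty_iff_ne_empty.2 hSe
  have hC₀E : C₀ ⊆ M.E := hC₀.1.subset_ground
  have heE : e ∈ M.E := hC₀E hC₀.2.2
  obtain ⟨x, hxC₀, hxe⟩ := exists_ne_of_one_lt_ncard (by rw [hC₀.2.1]; norm_num : 1 < C₀.ncard) e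
  have hxE : x ∈ M.E := hC₀E hxC₀
  have hne : ¬ M.IsColoop x := hC₀.1.not_isColoop_of_mem hxC₀
  have hν : M✶.eRank = ((m + 1 : ℕ) : ℕ∞) := by
    have h := _root_.Matroid.eRank_add_eRank_dual M
    rw [hd] at h
    exact WithTop.add_left_cancel (PercRepro.Matroid.eRank_ne_top_of_finite M) h
  have hdel := PercRepro.Matroid.dual_eRank_delete_singleton_add_one hxE hne
  rw [hν] at hdel
  have hfin' : (M ＼ {x})✶.eRank ≠ ⊤ := by
    intro h
    rw [h] at hdel
    have h2 : ((m + 1 : ℕ) : ℕ∞) = ⊤ := by rw [← hdel]; simp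
    exact ENat.coe_ne_top _ h2
  obtain ⟨m', hm'⟩ := ENat.ne_top_iff_exists.1 hfin'
  have hmm' : m = m' := by
    rw [← hm'] at hdel
    have : m' + 1 = m + 1 := by exact_mod_cast hdel
    omega
  subst hmm'
  have hd'enc : (M ＼ {x}).E.encard = (M ＼ {x}).eRank + m := by
    have h := _root_.Matroid.eRank_add_eRank_dual (M ＼ {x})
    rw [← hm'] at h
    exact h.symm
  have hfree' := hfree_delete M hfree x
  set S₁ := {C : Set α | M.IsCircuit C ∧ C.ncard = 4 ∧ e ∈ C ∧ x ∈ C} with hS₁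
  set S₂ := {C : Set α | (M ＼ {x}).IsCircuit C ∧ C.ncard = 4 ∧ e ∈ C} with hS₂
  have hsplit : S ⊆ S₁ ∪ S₂ := by
    intro C hC
    by_cases h : x ∈ C
    · exact Or.inl ⟨hC.1, hC.2.1, hC.2.2, h⟩
    · exact Or.inr ⟨_root_.Matroid.delete_isCircuit_iff.2 ⟨hC.1, disjoint_singleton_right.2 h⟩, hC.2.1, hC.2.2⟩
  have hS₁fin : S₁.Finite := hSfin.subset (fun C hC => ⟨hC.1, hC.2.1, hC.2.2.1⟩)
  have hS₂fin : S₂.Finite :=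
    (M ＼ {x}).ground_finite.finite_subsets.subset (fun C hC => hC.1.subset_ground)
  have h1 : 2 * S₁.ncard ≤ 3 * (m + 1) := two_mul_ncard_fourCircuitsThroughPair_le M hfree hxe.symm hd
  have h1' : S₁.ncard ≤ 3 * (m + 1) / 2 := (Nat.le_div_iff_mul_le (by norm_num)).2 (by linarith)
  have heE' : e ∈ (M ＼ {x}).E := by
    rw [_root_.Matroid.delete_ground]; exact ⟨heE, fun h => hxe.symm (mem_singleton_iff.1 h)⟩
  have h2 : S₂.ncard ≤ B := hB (M ＼ {x}) hfree' hd'enc e heE'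
  have h3 : S.ncard ≤ S₁.ncard + S₂.ncard :=
    (ncard_le_ncard hsplit (hS₁fin.union hS₂fin)).trans (ncard_union_le _ _)
  omega

/-- **The star step on top of the cap**: on the core of nullity `d + 1`, `#4circ(e) ≤ ⌊3(d + 1)/2⌋ + Q` whenever
`FourCapSpec capPaper d Q`. -/
theorem ncard_fourCircuitsThrough_le_star_add_of_fourCapSpec (M : Matroid α) [M.Finite]
    (hfree : ∀ e ∈ M.E, ∃ A ⊆ M.E \ {e}, e ∉ M.closure A ∧ e ∉ M.closure ((M.E \ {e}) \ A))
    {d : ℕ} (hd : M.E.encard = M.eRank + (d + 1)) (e : α) {Q : ℕ} (hQ : FourCapSpec capPaper d Q) :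
    {C : Set α | M.IsCircuit C ∧ C.ncard = 4 ∧ e ∈ C}.ncard ≤ 3 * (d + 1) / 2 + Q :=
  ncard_fourCircuitsThrough_le_star_add_of_forall M hfree hd e
    (fun M' _ hfree' hj _ he' => ncard_fourCircuitsThrough_le_of_fourCapSpec M' hfree' hj he' hQ)

/-- The star step twice on the `ν = 5` instance: `#4circ(e) ≤ 10 + 20 = 30` on every core of nullity 7. -/
theorem ncard_fourCircuitsThrough_le_thirty_of_nullity_seven (M : Matroid α) [M.Finite]
    (hfree : ∀ e ∈ M.E, ∃ A ⊆ M.E \ {e}, e ∉ M.closure A ∧ e ∉ M.closure ((M.E \ {e}) \ A))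
    (hd : M.E.encard = M.eRank + 7) (e : α) (hQ5 : FourCapSpec capPaper 5 11) :
    {C : Set α | M.IsCircuit C ∧ C.ncard = 4 ∧ e ∈ C}.ncard ≤ 30 :=
  ncard_fourCircuitsThrough_le_star_add_of_forall M hfree (m := 6) hd e
    (fun M' _ hfree' hj e' _ => ncard_fourCircuitsThrough_le_star_add_of_fourCapSpec M' hfree' (d := 5) hj e' hQ5)

/-- The per-point sequence `1, 4, 5, 8, 11` up to nullity `5`, `20 = ⌊3·6/2⌋ + 11` at nullity `6` (the star step on
the `ν = 5` instance), `perPointBound` beyond. -/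
def qStarStar (j : ℕ) : ℕ := if j ≤ 5 then qStar j else if j = 6 then 20 else perPointBound j

/-- `Σ_{j ≤ 6} qStarStar j = 49`. -/
theorem capSum_qStarStar_six : capSum qStarStar 6 = 49 := by decide

/-- **`s₄ ≤ 49` on every core of nullity 6** — modulo EXACTLY the three computed instances `Q*(3) = 5`, `Q*(4) = 8`,
`Q*(5) = 11`: the nullity-6 per-point step is the star bound on top of the `ν = 5` instance (`≤ 9 + 11 = 20`), the
instances at `ν ≤ 2` are kernel theorems; `Q*(6)` is NOT used. -/
theorem ncard_fourCircuits_le_forty_nine (M : Matroid α) [M.Finite]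
    (hfree : ∀ e ∈ M.E, ∃ A ⊆ M.E \ {e}, e ∉ M.closure A ∧ e ∉ M.closure ((M.E \ {e}) \ A))
    (hd : M.E.encard = M.eRank + 6) (hQ3 : FourCapSpec capPaper 3 5) (hQ4 : FourCapSpec capPaper 4 8)
    (hQ5 : FourCapSpec capPaper 5 11) : {C : Set α | M.IsCircuit C ∧ C.ncard = 4}.ncard ≤ 49 := by
  classical
  have hQ := fourCapSpec_qStar_le_five hQ3 hQ4 hQ5
  have hq : ∀ (M' : Matroid α) [M'.Finite],
      (∀ e ∈ M'.E, ∃ A ⊆ M'.E \ {e}, e ∉ M'.closure A ∧ e ∉ M'.closure ((M'.E \ {e}) \ A)) →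
      ∀ j : ℕ, M'.E.encard = M'.eRank + j → ∀ e ∈ M'.E,
      {C : Set α | M'.IsCircuit C ∧ C.ncard = 4 ∧ e ∈ C}.ncard ≤ qStarStar j := by
    intro M' _ hfree' j hj e he
    by_cases hj5 : j ≤ 5
    · simp only [qStarStar, hj5, if_true]
      exact ncard_fourCircuitsThrough_le_of_fourCapSpec M' hfree' hj he (hQ j hj5)
    · by_cases hj6 : j = 6
      · subst hj6
        simp only [qStarStar, show ¬ (6 ≤ 5) by decide, if_false, if_true]
        exact ncard_fourCircuitsThrough_le_star_add_of_fourCapSpec M' hfree' (d := 5) hj e hQ5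
      · simp only [qStarStar, hj5, hj6, if_false]
        exact ncard_fourCircuitsThrough_le_perPointBound M' hfree' hj e
  have h := FourCircuitCap.ncard_fourCircuits_le_sum_of_perPoint qStarStar hq M hfree hd
  have h49 : (Finset.range (6 + 1)).sum qStarStar = 49 := capSum_qStarStar_six
  rw [h49] at h
  exact h


/-- The per-point sequence with two star steps: `1, 4, 5, 8, 11, 20, 30`, `perPointBound` beyond. -/
def qStarStar7 (j : ℕ) : ℕ := if j ≤ 5 then qStar j else if j = 6 then 20 else if j = 7 then 30 else perPointBound j

/-- `Σ_{j ≤ 7} qStarStar7 j = 79`. -/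
theorem capSum_qStarStar7_seven : capSum qStarStar7 7 = 79 := by decide

/-- **`s₄ ≤ 79` on every core of nullity 7** — modulo the same three computed instances `Q*(3..5)` (two star steps
on the `ν = 5` instance: per-point `20` at nullity 6, `30` at nullity 7). -/
theorem ncard_fourCircuits_le_seventy_nine (M : Matroid α) [M.Finite]
    (hfree : ∀ e ∈ M.E, ∃ A ⊆ M.E \ {e}, e ∉ M.closure A ∧ e ∉ M.closure ((M.E \ {e}) \ A))
    (hd : M.E.encard = M.eRank + 7) (hQ3 : FourCapSpec capPaper 3 5) (hQ4 : FourCapSpec capPaper 4 8)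
    (hQ5 : FourCapSpec capPaper 5 11) : {C : Set α | M.IsCircuit C ∧ C.ncard = 4}.ncard ≤ 79 := by
  classical
  have hQ := fourCapSpec_qStar_le_five hQ3 hQ4 hQ5
  have hq : ∀ (M' : Matroid α) [M'.Finite],
      (∀ e ∈ M'.E, ∃ A ⊆ M'.E \ {e}, e ∉ M'.closure A ∧ e ∉ M'.closure ((M'.E \ {e}) \ A)) →
      ∀ j : ℕ, M'.E.encard = M'.eRank + j → ∀ e ∈ M'.E,
      {C : Set α | M'.IsCircuit C ∧ C.ncard = 4 ∧ e ∈ C}.ncard ≤ qStarStar7 j := by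
    intro M' _ hfree' j hj e he
    by_cases hj5 : j ≤ 5
    · simp only [qStarStar7, hj5, if_true]
      exact ncard_fourCircuitsThrough_le_of_fourCapSpec M' hfree' hj he (hQ j hj5)
    · by_cases hj6 : j = 6
      · subst hj6
        simp only [qStarStar7, show ¬ (6 ≤ 5) by decide, if_false, if_true]
        exact ncard_fourCircuitsThrough_le_star_add_of_fourCapSpec M' hfree' (d := 5) hj e hQ5
      · by_cases hj7 : j = 7
        · subst hj7
          simp only [qStarStar7, show ¬ (7 ≤ 5) by decide, show (7 : ℕ) ≠ 6 by decide, if_false, if_true]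
          exact ncard_fourCircuitsThrough_le_thirty_of_nullity_seven M' hfree' hj e hQ5
        · simp only [qStarStar7, hj5, hj6, hj7, if_false]
          exact ncard_fourCircuitsThrough_le_perPointBound M' hfree' hj e
  have h := FourCircuitCap.ncard_fourCircuits_le_sum_of_perPoint qStarStar7 hq M hfree hd
  have h79 : (Finset.range (7 + 1)).sum qStarStar7 = 79 := capSum_qStarStar7_seven
  rw [h79] at h
  exact h

end S1

end PercRepro
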